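import Summits.CriticalPhenomena.PercolationContinuityZ3.Theorems.Transplant.SkelConcExcess
import HarnessLib

/-!
# L7.1b — the generic EXCESS RADIUS AT THE RUNNING PARAMETER as a function (generic twin of `BoxProdZ2.excessRadiusAt`, ConcParamsKit §2):
# a classical choice in hp-8 g22's centre-uniform `Skel.exists_excess_radius_uniform` (L4.7), with its specification in the `hR₁` shape of
# `Skel.real_rim_le_of_radius` / `Skel.real_rim_le_of_wired_source` at EVERY centre

builds on p205010 (kernel theorem, internal audit signed; external expert review pending) — nothing in this file uses p205010.
Status sentence (coordinator 2026-08-20T04:30Z): "θ(p_c) = 0 on ℤ^d, all d ≥ 2 — kernel-verified (Lean 4/Mathlib, standard axioms); internal adversarial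
audit SIGNED 2026-08-20 04:29Z; external expert review pending."
Lane `prim-bschramm-*`, seat `prim-bschramm-stmt` (gen 7); helper file (`--supports stmt-CriticalPhenomena-4575`).
Parameter ledger: `run/shared/lean/prim/bschramm/prim-bschramm-stmt/CONC-PARAMS-GENERIC.md` §1 row Rexc, §5 (D7).  In the product the
one function `excessRadiusAt X (insert w reps) n η q R₀'` served the root-centred faces (`hR₁`, `τ ∈ {w₀}`) and the contact-centred wired
sources (`hRexV`, `τ ∈ reps`, transported by frames); over a skeleton the radius of `exists_excess_radius_uniform` is independent of the
centre (the entrance count is `≤ (Δ+1)^ρ` by the degree bound), so ONE function with NO centre argument serves both.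

* **`SkelConc.excessRadiusAtK Φ m η q ρ`** — planar diameter `m`, tolerance `η`, running parameter `q`, entrance depth `ρ`; the uniform
  radius when `Φ.CylSubcritical q ∧ 0 < η`, else `0`;
* `excessRadiusAtK_spec` (all centres at once), `excessRadiusAtK_spec_at c` (= the `hR₁` hypothesis of `real_rim_le_of_radius` at the
  centre `c` with `R₀' := ρ`), `excessRadiusAtK_spec_succ_at c` (entrance depth `ρ + 1`: the product's `R₁ ρ := Rex (ρ + 1)` shape),
  `excessRadiusAtK_spec_le` (coarser tolerance), `excessRadiusAtK_of_not`.
[cite: KozmaNitzan2024, §4 Lemma 12 (p. 24)] [cite: MartineauSevero2019, Cor. 2.2]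
-/

noncomputable section

open MeasureTheory
open scoped Classical

namespace Summit.CriticalPhenomena.PercolationContinuityZ3.Theorems

namespace Transplant

namespace SkelConc

open Literature.Probability.Percolation Literature.Probability.LatticeModels SimpleGraph
open Literature.Barriers.CriticalPhenomena (graphBall)

variable {V : Type} [Countable V] {G : SimpleGraph V} [G.LocallyFinite] (Φ : PlanarSkeletonConc G)

/-- **The excess radius at the running parameter `q`** (planar diameter `m`, tolerance `η`, entrance depth `ρ`), uniform over the centre:
the radius of `Skel.exists_excess_radius_uniform` when `Φ.CylSubcritical q ∧ 0 < η`, else `0`. [cite: KozmaNitzan2024, §4 Lemma 12 (p. 24)]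
[cite: MartineauSevero2019, Cor. 2.2] -/
def excessRadiusAtK (m : ℕ) (η : ℝ) (q : unitInterval) (ρ : ℕ) : ℕ :=
  if h : Φ.toPlanarSkeleton.CylSubcritical q ∧ 0 < η then Classical.choose (Skel.exists_excess_radius_uniform Φ h.1 ρ m h.2) else 0

/-- **Specification, all centres at once**: beyond `excessRadiusAtK Φ m η q ρ`, at EVERY centre `c`, every habitat `D ⊆ B_G(c, Rw)` of planar
diameter `≤ m` with entrances `A ⊆ D` at depth `≤ ρ` from `c` has `P_q(excess c R D A) ≤ η`. [cite: KozmaNitzan2024, §4 Lemma 12 (p. 24)] -/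
theorem excessRadiusAtK_spec (m : ℕ) {η : ℝ} (hη : 0 < η) {q : unitInterval} (hC : Φ.toPlanarSkeleton.CylSubcritical q) (ρ : ℕ) :
    ∀ (c : V) (R : ℕ), excessRadiusAtK Φ m η q ρ ≤ R → ∀ (Rw : ℕ) (D A : Finset V), (∀ d ∈ D, d ∈ graphBall G c Rw) →
      (∀ d ∈ D, ∀ d' ∈ D, Φ.φ d - Φ.φ d' ∈ box 2 m) → A ⊆ D → (∀ a ∈ A, a ∈ graphBall G c ρ) →
        (bondPercolation G q).real (Skel.excess G c R D A) ≤ η := by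
  have h : Φ.toPlanarSkeleton.CylSubcritical q ∧ 0 < η := ⟨hC, hη⟩
  rw [excessRadiusAtK, dif_pos h]
  exact Classical.choose_spec (Skel.exists_excess_radius_uniform Φ h.1 ρ m h.2)

/-- **Specification at one centre `c`** — literally the `hR₁` hypothesis of `Skel.real_rim_le_of_radius` / `real_rim_le_of_wired_source` with
`R₀' := ρ` and `R₁ := excessRadiusAtK Φ m η q ρ`. [folklore] -/
theorem excessRadiusAtK_spec_at (m : ℕ) {η : ℝ} (hη : 0 < η) {q : unitInterval} (hC : Φ.toPlanarSkeleton.CylSubcritical q) (ρ : ℕ) (c : V) :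
    ∀ R, excessRadiusAtK Φ m η q ρ ≤ R → ∀ (Rw : ℕ) (D A : Finset V), (∀ d ∈ D, d ∈ graphBall G c Rw) →
      (∀ d ∈ D, ∀ d' ∈ D, Φ.φ d - Φ.φ d' ∈ box 2 m) → A ⊆ D → (∀ a ∈ A, a ∈ graphBall G c ρ) →
        (bondPercolation G q).real (Skel.excess G c R D A) ≤ η :=
  excessRadiusAtK_spec Φ m hη hC ρ c

/-- **The entrance-depth-`ρ + 1` form at one centre** (the product's `R₁ ρ := Rex (ρ + 1)`). [folklore] -/
theorem excessRadiusAtK_spec_succ_at (m : ℕ) {η : ℝ} (hη : 0 < η) {q : unitInterval} (hC : Φ.toPlanarSkeleton.CylSubcritical q) (c : V) :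
    ∀ ρ R, excessRadiusAtK Φ m η q (ρ + 1) ≤ R → ∀ (Rw : ℕ) (D A : Finset V), (∀ d ∈ D, d ∈ graphBall G c Rw) →
      (∀ d ∈ D, ∀ d' ∈ D, Φ.φ d - Φ.φ d' ∈ box 2 m) → A ⊆ D → (∀ a ∈ A, a ∈ graphBall G c (ρ + 1)) →
        (bondPercolation G q).real (Skel.excess G c R D A) ≤ η :=
  fun ρ => excessRadiusAtK_spec_at Φ m hη hC (ρ + 1) c

/-- The specification transferred to a COARSER tolerance `η ≤ η'` (one radius at the minimal tolerance serves every residue). [folklore] -/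
theorem excessRadiusAtK_spec_le (m : ℕ) {η η' : ℝ} (hη : 0 < η) (hη' : η ≤ η') {q : unitInterval}
    (hC : Φ.toPlanarSkeleton.CylSubcritical q) (ρ : ℕ) (c : V) :
    ∀ R, excessRadiusAtK Φ m η q ρ ≤ R → ∀ (Rw : ℕ) (D A : Finset V), (∀ d ∈ D, d ∈ graphBall G c Rw) →
      (∀ d ∈ D, ∀ d' ∈ D, Φ.φ d - Φ.φ d' ∈ box 2 m) → A ⊆ D → (∀ a ∈ A, a ∈ graphBall G c ρ) →
        (bondPercolation G q).real (Skel.excess G c R D A) ≤ η' :=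
  fun R hR Rw D A hD hm hAD hA => (excessRadiusAtK_spec_at Φ m hη hC ρ c R hR Rw D A hD hm hAD hA).trans hη'

/-- The radius is monotone-usable: any `R' ≥ R ≥ excessRadiusAtK …` also works (restatement for `omega`-side bookkeeping). [folklore] -/
theorem excessRadiusAtK_le_trans {m : ℕ} {η : ℝ} {q : unitInterval} {ρ R R' : ℕ} (h : excessRadiusAtK Φ m η q ρ ≤ R) (h' : R ≤ R') :
    excessRadiusAtK Φ m η q ρ ≤ R' :=
  h.trans h'

/-- Off the regime (`¬ CylSubcritical q` or `η ≤ 0`) the radius is `0` (bookkeeping). [folklore] -/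
theorem excessRadiusAtK_of_not (m : ℕ) {η : ℝ} {q : unitInterval} (h : ¬ (Φ.toPlanarSkeleton.CylSubcritical q ∧ 0 < η)) (ρ : ℕ) :
    excessRadiusAtK Φ m η q ρ = 0 := by
  rw [excessRadiusAtK, dif_neg h]

end SkelConc

end Transplant

end Summit.CriticalPhenomena.PercolationContinuityZ3.Theorems

end
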